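import Summits.ABC.IUTFork.Repair.RHLWindowTable
import Literature.IUT.LogVolume.Corollary22FreyPoint
import HarnessLib

/-!
# D-0079 RESCUE sub-cell R-H, D-0121 (2) «L-WINDOW» — the FREY FAMILY at the genuine points, no numerals: for EVERY abc triple with
# `log c ≤ 11 059 199` the content side of [IUTchIV] Thm. 1.10's display fails at `(λ = a/c, l)` for EVERY `l ≥ 1` — the window is EMPTY

PROOF-ONLY sequel (0 definitions) of `RHLWindowTable` (p488757: §1 `not_content_of_logQNotTwo_le`, `display_of_logQNotTwo_le`,
`displayWith_of_logQNotTwo_le`; §2 the 253-row table; §3 the K-line `k ≤ 5.5·10⁶`) and `RHLWindowKLine` (p489222: the K-line for every `k`), using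
abc-iut-S6's Frey–Legendre dictionary `Corollary22FreyPoint` (`Cor22.htInfty_ratPoint_triple_le`: `ht_∞(a/c) ≤ 6·log c + log 256`) and abc-iut-S-d2's
`Cor22.logQForall_le_htInfty`. Seat abc-iut-lwin-typ-1 gen 0; abc-iut-rh-lead g3 D0121-SPEC §2 (the `frey` family of the genuine bed: 37 rows in B23,
FREY133 / FREY482 in GRADING-R3); referee rh2-exp-ref; rung LADDER-ABC:A2.RESCUE.H.

THE POINT. The tables certify the frey rows one by one (`RHLWindowTable.lwindow_empty_all`, `RHLWindowTableKit`); but the content side of the window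
depends on the datum only through its height, and for the Frey–Legendre point `λ = a/c` of an abc triple the tree KNOWS the height:
`log q^{∤{2,l}}(a/c) ≤ log q^{∤2}(a/c) ≤ log q^∀(a/c) ≤ ht_∞(a/c) ≤ 6·log c + log 256 ≤ 6·log c + 6`. Hence (`lt_of_content_ratPoint_triple`) the content
guard at `(ratPoint (a/c), l)` forces **`120·552960·l < 6·log c + 6`, i.e. `11 059 200·l < log c + 1`** — a window can open at the prime `l` only for
triples with `c > e^{11 059 200·l − 1}` (at the least admissible `l = 5`: `c > 10^{24 000 000}`); and (`not_content_ratPoint_triple`) for EVERY abc triple with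
`log c ≤ 11 059 199` — every triple of every table of the cell, and every triple that will ever be tabulated — the guard fails at EVERY `l ≥ 1`, so the
D-0121 (2) window is EMPTY WHATEVER THE SLICE THRESHOLD (`l_all⁸`, `l_all¹⁵`, LIN, `(l_all⁸)⁴`), and print's display / every `Λ`-dilated display is free
there (`display_ratPoint_triple`, `displayWith_ratPoint_triple`, BY NAME through abc-iut-C-cert-1's `Conditional.display_of_not_content`).
HONEST SCOPE. Statements about the actual `NFPoint` `ratPoint (a/c)` of [GenEll] Thm. 2.1 / [IUTchIV] Cor. 2.2, unconditional and elementary; the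
slice side (A) is not touched (it is not needed). Nothing here asserts that abc is proved or refuted, or that [IUTchIII] Cor. 3.12 / [IUTchIV] Thm. 1.10
holds or fails anywhere; no side is taken on any author; «the display is free» is print's own additive constant `20·d*_mod·l`, not a verification of
print; typed ≠ proved. [cite: Mochizuki2012, IUTchIV Thm. 1.10 pp. 22–23, Cor. 2.2 (i) p. 41, (ii) p. 46 l. 1] [cite: MochizukiGenEll2010, Thm 2.1 p.11]
[cite: SilvermanAEC2009, §VIII.11] [claim: Mochizuki2012, status: disputed] for every IUT locution.
-/

noncomputable section

open Set Function NumberField IsDedekindDomain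

namespace Summit.ABC.IUTFork.Repair.RH.LWindowTable

open Literature.IUT.LogVolume Literature.IUT.LogVolume.Cor22
open Literature.NumberTheory.DiophantineGeometry Literature.NumberTheory.DiophantineGeometry.GenEll Summit.ABC.IUTFork.Conditional

/-- `log 256 ≤ 6` (`log 256 = 8·log 2 < 8·0.6932`). [folklore] -/
theorem log_256_le_six : Real.log 256 ≤ 6 := by
  have h : Real.log 256 = 8 * Real.log 2 := by
    rw [show (256 : ℝ) = 2 ^ 8 by norm_num, Real.log_pow]
    norm_num
  rw [h]
  linarith [Real.log_two_lt_d9]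

/-- **The height of a Frey–Legendre point, in the window's currency:** for an abc triple `a + b = c`,
`log q^{∤2}(a/c) ≤ 6·log c + 6` (`logQAvoid_le_logQNotTwo_le`, `logQForall_le_htInfty`, `htInfty_ratPoint_triple_le`, `log 256 ≤ 6`).
[cite: Mochizuki2012, IUTchIV Cor. 2.2 (i) p. 41] [cite: MochizukiGenEll2010, Thm 2.1 p.11] -/
theorem logQNotTwo_ratPoint_triple_le {a b c : ℕ} (h : IsABCTriple a b c) :
    logQNotTwo (ratPoint ((a : ℚ) / c)) ≤ 6 * Real.log c + 6 := by
  have h1 := (logQAvoid_le_logQNotTwo_le (ratPoint ((a : ℚ) / c)) 2).2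
  have h2 := logQForall_le_htInfty (ratPoint ((a : ℚ) / c))
  have h3 := htInfty_ratPoint_triple_le h
  linarith [log_256_le_six]

/-- **`lt_of_content_ratPoint_triple` — WHAT A WINDOW AT `l` WOULD COST A TRIPLE.** If the content guard of [IUTchIV] Thm. 1.10's display holds at
`(ratPoint (a/c), l)` then `120·552960·l < 6·log c + 6`, i.e. `11 059 200·l < log c + 1`: the triple must have `c > e^{11 059 200·l − 1}`.
(`RHLWindowTable.not_content_of_logQNotTwo_le` contraposed, with `logQNotTwo_ratPoint_triple_le`.) [cite: Mochizuki2012, IUTchIV Thm. 1.10 pp. 22–23] -/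
theorem lt_of_content_ratPoint_triple {a b c l : ℕ} (h : IsABCTriple a b c)
    (hc : 6 * ((1 + 20 * (dmod (ratPoint ((a : ℚ) / c)) : ℝ) / l)
            * ((ratPoint ((a : ℚ) / c)).logDiff + logCondAvoid (ratPoint ((a : ℚ) / c)) {2, l}))
          + 120 * (2 ^ 12 * 3 ^ 3 * 5 * (dmod (ratPoint ((a : ℚ) / c)) : ℝ) * l)
        < logQAvoid (ratPoint ((a : ℚ) / c)) {2, l}) :
    (11059200 : ℝ) * l < Real.log c + 1 := by
  by_contra hle
  push Not at hle
  refine not_content_of_logQNotTwo_le (lA := l) le_rfl (logQNotTwo_ratPoint_triple_le h) ?_ hc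
  linarith

/-- **`not_content_ratPoint_triple` — THE FREY FAMILY, EVERY TRIPLE WITH `log c ≤ 11 059 199`, EVERY `l ≥ 1`: the content guard FAILS** at
`(ratPoint (a/c), l)` — `6·log c + 6 ≤ 66 355 200 ≤ 120·552960·l`. So the D-0121 (2) window is EMPTY for every such triple whatever the slice threshold;
the 37 frey rows of B23 / FREY133 / FREY482 (`c < 10^{30}`) are instances with twenty-odd million nats to spare.
[cite: Mochizuki2012, IUTchIV Thm. 1.10 pp. 22–23] [cite: MochizukiGenEll2010, Thm 2.1 p.11] -/
theorem not_content_ratPoint_triple {a b c l : ℕ} (h : IsABCTriple a b c) (hc : Real.log c ≤ 11059199) (hl : 1 ≤ l) :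
    ¬ (6 * ((1 + 20 * (dmod (ratPoint ((a : ℚ) / c)) : ℝ) / l)
            * ((ratPoint ((a : ℚ) / c)).logDiff + logCondAvoid (ratPoint ((a : ℚ) / c)) {2, l}))
          + 120 * (2 ^ 12 * 3 ^ 3 * 5 * (dmod (ratPoint ((a : ℚ) / c)) : ℝ) * l)
        < logQAvoid (ratPoint ((a : ℚ) / c)) {2, l}) := by
  refine not_content_of_logQNotTwo_le (lA := 1) hl (logQNotTwo_ratPoint_triple_le h) ?_
  push_cast
  linarith

/-- **Hence print's display is FREE at every such `(a/c, l)`** (`η > 0`): abc-iut-C-cert-1's `Conditional.display_of_not_content` BY NAME.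
[cite: Mochizuki2012, IUTchIV Thm. 1.10 pp. 22–23; Cor. 2.2 (ii) p. 46 l. 1] [claim: Mochizuki2012, status: disputed] -/
theorem display_ratPoint_triple {a b c l : ℕ} {η : ℝ} (h : IsABCTriple a b c) (hc : Real.log c ≤ 11059199) (hl : 1 ≤ l) (hη : 0 < η) :
    Display (ratPoint ((a : ℚ) / c)) l η :=
  display_of_not_content hη (not_content_ratPoint_triple h hc hl)

/-- **… and so is every `Λ`-dilated display of the EXP programme** (`Λ ≥ 1`, `η > 0`; `Cor22.DisplayWith.of_display`).
[claim: Mochizuki2012, status: disputed] -/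
theorem displayWith_ratPoint_triple {a b c l : ℕ} {η Λ : ℝ} (h : IsABCTriple a b c) (hc : Real.log c ≤ 11059199) (hl : 1 ≤ l)
    (hη : 0 < η) (hΛ : 1 ≤ Λ) : DisplayWith (ratPoint ((a : ℚ) / c)) l η Λ :=
  DisplayWith.of_display hη.le hΛ (display_ratPoint_triple h hc hl hη)

/-- **Exponential form of the hypothesis:** `c ≤ e^{11 059 199}` (every triple of the cell's R-W / FREY beds has `c < 10^{30} < e^{70}`).
[folklore] -/
theorem not_content_ratPoint_triple_of_le_exp {a b c l : ℕ} (h : IsABCTriple a b c) (hc : (c : ℝ) ≤ Real.exp 11059199) (hl : 1 ≤ l) :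
    ¬ (6 * ((1 + 20 * (dmod (ratPoint ((a : ℚ) / c)) : ℝ) / l)
            * ((ratPoint ((a : ℚ) / c)).logDiff + logCondAvoid (ratPoint ((a : ℚ) / c)) {2, l}))
          + 120 * (2 ^ 12 * 3 ^ 3 * 5 * (dmod (ratPoint ((a : ℚ) / c)) : ℝ) * l)
        < logQAvoid (ratPoint ((a : ℚ) / c)) {2, l}) := by
  refine not_content_ratPoint_triple h ?_ hl
  have hc0 : (0 : ℝ) < c := by
    have h1 := h.1; have h3 := h.2.2.1
    exact_mod_cast (show 0 < c by omega)
  exact (Real.log_le_iff_le_exp hc0).2 hc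

end Summit.ABC.IUTFork.Repair.RH.LWindowTable

end
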